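import Summits.Langlands.Langlands.Theorems.IrreducibilityBySelfDualityPairLBoundaryJSCornerGlobalTranslate
import Literature.NumberTheory.Automorphic.JPSSUnfoldedPairIntegralEntire
import Literature.NumberTheory.Automorphic.AdelicGroupDataAutomorphicMeasureProofs

/-!
# The corner instance `(m+1, m)` of the named fact `Cogdell2004_unfoldedPairIntegral_entire` is a theorem

Summit `Langlands`, sub-problem `Langlands`, helper file under `Theorems/` supporting the crux
`PairLBoundaryJS` (stmt-Langlands-13622), line `Sketch`, registered sub-stub `stub_gap_entire_fact_succ`:
a TRANSCRIPTION SANITY CHECK of the Literature named fact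
`Cogdell2004_unfoldedPairIntegral_entire n m K` (`JPSSUnfoldedPairIntegralEntire`; Cogdell (2004), Thm. 2.1,
analytic clause, in unfolded form). Its corner instance `n = m + 1` (`0 < m`) is PROVED from the tree's corner
road: for honest cusp forms `Φ` on `GL_{m+1}(𝔸_K)`, `Φ'` on `GL_m(𝔸_K)` (`IsCuspFormGL`, `A_G`-invariant) and
Haar measures `νA`, `νK`, `ν₀`, `ν₀'`, there are `x₀` and an ENTIRE `J` with

  `J(s) = ∫ W_Φ(ι(a k)) conj W_{Φ'}(a k) |det a|^s δ_B(a)⁻¹ d(νA ⊗ νK)(a, k)`  (`re s > x₀`),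

`W_Φ = whittakerCoeff ν₀ (unipotentTateDomain (m+1) K) (adeleAddChar K) Φ`, `ι = glCorner = diag(·, 1)`.

Assembly (the first half of `CornerGlobalTranslate.jpssIntegral_star_eq`, without the translate and Euler
steps): (a) `Φ`, `Φ'` descend to the automorphic quotients (`AdelicGroupData.descend`,
`leftInvariant_quotientSubgroup`, `invQuot_descend`); (b) an automorphic measure `μ'` on `X_m` exists
(`AdelicGroupData.exists_isAutomorphicMeasure_gl_holds`, Borel–Harish-Chandra); (c) the global corner theorem
`CornerGlobal.jpssIntegral_eq_mul_integral_torusPairIntegrandC` at `(φ, φ̄')` and the parameter `s + 1/2`,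
its torus hypothesis from `CornerAbsConvergence.stub_corner_abs_convergence_one_of_torus_majorant` with
`CornerAbsTorusMajorant.stub_corner_torus_majorant` on `re s ≥ σ₀`; (d) the bridge
`whittakerDepth_zero_eq_whittakerCoeff` (`Φ_0 = W_Φ`) and
`conj ∘ whittakerDepth 0 (conj ∘ Φ') = star ∘ W_{Φ'}`; (e) `J(s) = C⁻¹ I(s + 1/2; φ, φ̄')`, entire by
`differentiable_jpssIntegral_of_isCuspFormGL` (`JPSSGlobalIntegral`, Cogdell's Thm. 2.1, first clause, for
the corner).

This does not change the conditional status of the crux (the fact is consumed for `m + 2 ≤ n`); it certifies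
that the transcription of Cogdell's analytic clause has the right shape.

## References

* J. W. Cogdell, *Analytic theory of L-functions for GL_n*, in *An Introduction to the Langlands
  Program* (2004), §2.2–2.3, Thm. 2.1 [CogdellAnalyticTheory2004].
* H. Jacquet, I. I. Piatetski-Shapiro, J. Shalika, *Rankin–Selberg convolutions*, Amer. J. Math.
  105 (1983), §2 [JacquetPiatetskiShapiroShalika1983].
-/

noncomputable section

-- `Summit.Langlands.Langlands.…` (summit = sub-problem name, D-0017 layout) trips `dupNamespace`
set_option linter.dupNamespace false

open scoped MatrixGroups Topology Pointwise ENNReal NNReal ComplexConjugate InnerProductSpace ContDiff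
-- the place subtypes indexing `mixedSpace K` are `Fintype` classically (`NormedCommRing (mixedSpace K)`)
open scoped Classical Matrix.Norms.Operator
open NumberField IsDedekindDomain MeasureTheory Measure Matrix Set Filter WithZero
open NumberField.mixedEmbedding
open Literature.NumberTheory.Automorphic AdelicGroupData
open Literature.NumberTheory.GaloisRepresentations (ideleGroup HeckeCharacter)
open Literature.MeasureTheory.Group
open Literature.RingTheory.SymmetricFunctions.SymmPoly
open ValuativeRel

-- the automorphic quotient carries the tree's Borel σ-algebra, not Mathlib's quotient σ-algebra
attribute [-instance] Quotient.instMeasurableSpace QuotientGroup.measurableSpace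

-- the house local instances, exactly as in `RankinSelbergUnfoldingIdentity`
attribute [local instance] adelicBorel borelSpace_adelic locallyCompactSpace_adelic secondCountableTopology_gl_adelic
  glAdeleBorel borelSpace_glAdele borelSpace_ideleGroup secondCountableTopology_ideleGroup

-- Mathlib idiom: the commutator Lie ring on matrices, to mention `(archGroupGL n K).lie`
attribute [local instance 100] LieRing.ofAssociativeRing

namespace Summit.Langlands.Langlands.Theorems.GapEntireFactSucc

/-! ### The corner integral `I(s + 1/2; φ, φ̄')` unfolded to the torus, in the Whittaker coefficients -/

section Main

variable {m : ℕ} {K : Type} [Field K] [NumberField K]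
  [MeasurableSpace (AdeleRing (𝓞 K) K)] [BorelSpace (AdeleRing (𝓞 K) K)]

local notation "𝔸" => AdeleRing (𝓞 K) K

/-- **The global corner theorem at `(φ, φ̄')` in the Whittaker coefficients, on a right half-plane**
(Cogdell (2004), §2.2–2.3, Thm. 2.1; Jacquet–Piatetski-Shapiro–Shalika (1983), §2): for `0 < m`, an
automorphic measure `μ'` on `X_m`, Haar measures `νA`, `νK`, `ν₀`, `ν₀'` and honest cusp forms `φ` on
`X_{m+1}`, `φ'` on `X_m` there are `C > 0` and `x₀` with, for `re s > x₀`,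
`I(s + 1/2; φ, φ̄') = C ∫ W_Φ(ι(a k)) conj W_{Φ'}(a k) |det a|^s δ_B(a)⁻¹ d(νA ⊗ νK)`
(`W_Φ = whittakerCoeff ν₀ (unipotentTateDomain (m+1) K) (adeleAddChar K) Φ`, `Φ = invQuot φ`, likewise
`W_{Φ'}`): `CornerGlobal.jpssIntegral_eq_mul_integral_torusPairIntegrandC` at `s + 1/2`, its torus hypothesis from
`CornerAbsConvergence.stub_corner_abs_convergence_one_of_torus_majorant`, and the bridge
`whittakerDepth_zero_eq_whittakerCoeff`. [cite: CogdellAnalyticTheory2004, §2.2–2.3 Thm. 2.1] -/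
theorem jpssIntegral_star_add_half_eq (hm : 0 < m)
    (μ' : Measure (AdelicGroupData.gl m K).automorphicQuotient) [(AdelicGroupData.gl m K).IsAutomorphicMeasure μ']
    (νA : Measure (Fin m → ideleGroup K)) [IsHaarMeasure νA]
    (νK : Measure ↥(maximalCompactAdelic m K)) [IsHaarMeasure νK]
    (ν₀ : Measure ↥(adelicUnipotent (m + 1) K)) [IsHaarMeasure ν₀]
    (ν₀' : Measure ↥(adelicUnipotent m K)) [IsHaarMeasure ν₀']
    {φ : (AdelicGroupData.gl (m + 1) K).automorphicQuotient → ℂ}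
    (hcusp : IsCuspFormGL (m + 1) K (isCompact_glFiniteIntegralLevel_holds (m + 1) K)
      (invQuot (AdelicGroupData.gl (m + 1) K) φ))
    {φ' : (AdelicGroupData.gl m K).automorphicQuotient → ℂ}
    (hcusp' : IsCuspFormGL m K (isCompact_glFiniteIntegralLevel_holds m K) (invQuot (AdelicGroupData.gl m K) φ')) :
    ∃ C x₀ : ℝ, 0 < C ∧ ∀ s : ℂ, x₀ < s.re →
      jpssIntegral (Nat.lt_succ_self m) μ' φ (star φ') (s + 1 / 2) =
        (C : ℂ) * ∫ p, torusPairIntegrandC m K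
          (fun g => whittakerCoeff ν₀ (unipotentTateDomain (m + 1) K) (adeleAddChar K)
            (invQuot (AdelicGroupData.gl (m + 1) K) φ) (glCorner (AdeleRing (𝓞 K) K) (Nat.le_succ m) g))
          (fun g => star (whittakerCoeff ν₀' (unipotentTateDomain m K) (adeleAddChar K)
            (invQuot (AdelicGroupData.gl m K) φ') g))
          (fun _ => (1 : ℝ)) s p ∂(νA.prod νK) := by
  -- the constant of the global corner theorem
  obtain ⟨C, hC, hG⟩ := CornerGlobal.jpssIntegral_eq_mul_integral_torusPairIntegrandC hm μ' νA νK
  -- the classical functions `Φ`, `Φ'` and the bridges `Φ_0 = W_Φ`, `conj (Φ̄')_0 = star W_{Φ'}`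
  set Φ : GL (Fin (m + 1)) 𝔸 → ℂ := invQuot (AdelicGroupData.gl (m + 1) K) φ with hΦdef
  set Φ' : GL (Fin m) 𝔸 → ℂ := invQuot (AdelicGroupData.gl m K) φ' with hΦ'def
  have hΦc : Continuous Φ := hcusp.1.continuous_gl
  have hΦ'c : Continuous Φ' := hcusp'.1.continuous_gl
  have hΦA : ∀ z ∈ (AdelicGroupData.gl (m + 1) K).center', ∀ g : (AdelicGroupData.gl (m + 1) K).Adelic,
      Φ (z * g) = Φ g := fun z hz g => invQuot_mul_left _ φ (Subgroup.mem_sup_left hz) g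
  have hW₀ : ∀ g, whittakerDepth 0 Φ g =
      whittakerCoeff ν₀ (unipotentTateDomain (m + 1) K) (adeleAddChar K) Φ g :=
    fun g => whittakerDepth_zero_eq_whittakerCoeff hΦc (Nat.succ_le_succ (Nat.zero_le m)) ν₀ g
  have hcc : (fun x : GL (Fin m) 𝔸 => conj (invQuot (AdelicGroupData.gl m K) (star φ') x)) = Φ' := by
    funext x
    simp only [hΦ'def, invQuot_apply, Pi.star_apply, starRingEnd_apply, star_star]
  have hW₁ : ∀ g, whittakerDepth 0 (fun x => conj (invQuot (AdelicGroupData.gl m K) (star φ') x)) g =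
      whittakerCoeff ν₀' (unipotentTateDomain m K) (adeleAddChar K) Φ' g := fun g => by
    rw [hcc]
    exact whittakerDepth_zero_eq_whittakerCoeff hΦ'c hm ν₀' g
  -- the right half-plane: one-factor absolute convergence beyond `σ₀`
  obtain ⟨σ₀, hσ₀⟩ := CornerAbsConvergence.stub_corner_abs_convergence_one_of_torus_majorant
    CornerAbsTorusMajorant.stub_corner_torus_majorant hm νA νK hcusp hΦA
  refine ⟨C, σ₀, hC, fun s hs => ?_⟩
  have hre : (s + 1 / 2).re - 1 / 2 = s.re := by simp [Complex.add_re]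
  have hfin := hσ₀ ((s + 1 / 2).re - 1 / 2) (by rw [hre]; exact hs.le)
  -- the global corner theorem at `(φ, φ̄')` and `s + 1/2`
  have hφ'star : IsCuspFormGL m K (isCompact_glFiniteIntegralLevel_holds m K)
      (invQuot (AdelicGroupData.gl m K) (star φ')) := hcusp'.star
  have hglob := hG (φ := φ) hcusp (φ' := star φ') hφ'star (s + 1 / 2) hfin
  have hs2 : s + 1 / 2 - 1 / 2 = s := by ring
  have h01 : ∀ p, torusPairIntegrandC m K (fun g => whittakerDepth 0 Φ (glCorner 𝔸 (Nat.le_succ m) g))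
      (fun g => conj (whittakerDepth 0 (fun x => conj (invQuot (AdelicGroupData.gl m K) (star φ') x)) g))
      (fun _ => (1 : ℝ)) (s + 1 / 2 - 1 / 2) p = torusPairIntegrandC m K
        (fun g => whittakerCoeff ν₀ (unipotentTateDomain (m + 1) K) (adeleAddChar K) Φ
          (glCorner 𝔸 (Nat.le_succ m) g))
        (fun g => star (whittakerCoeff ν₀' (unipotentTateDomain m K) (adeleAddChar K) Φ' g))
        (fun _ => (1 : ℝ)) s p := fun p => by
    rw [hs2]
    simp only [torusPairIntegrandC, hW₀, hW₁]
    rfl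
  rw [hglob]
  exact congrArg (fun z : ℂ => (C : ℂ) * z) (integral_congr_ae (Eventually.of_forall h01))

end Main

/-! ### The registered sub-stub -/

/-- **STUB — the corner instance `(m+1, m)` of the named fact `Cogdell2004_unfoldedPairIntegral_entire` is a
THEOREM of the tree** (Cogdell (2004), Thm. 2.1, analytic clause, `n = m + 1`; Jacquet–Piatetski-Shapiro–Shalika
(1983), §2): the honest forms descend to the automorphic quotients (`AdelicGroupData.descend`,
`leftInvariant_quotientSubgroup`, `invQuot_descend`), an automorphic measure `μ'` on `X_m` exists
(`AdelicGroupData.exists_isAutomorphicMeasure_gl_holds`), and `J(s) = C⁻¹ I(s + 1/2; φ, φ̄')` is entire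
(`differentiable_jpssIntegral_of_isCuspFormGL`) and equals the fact's torus integral for `re s > x₀`
(`jpssIntegral_star_add_half_eq`). [cite: CogdellAnalyticTheory2004, §2.2–2.3 Thm. 2.1] -/
theorem stub_gap_entire_fact_succ :
    ∀ (m : ℕ) (K : Type) [Field K] [NumberField K], 0 < m → Cogdell2004_unfoldedPairIntegral_entire (m + 1) m K := by
  intro m K _ _ hm hmn _ _ _ νA _ νK _ ν₀ _ ν₀' _ Φ Φ' hcusp hcusp' hΦA hΦ'A
  -- (a) descend the honest forms to the automorphic quotients
  obtain ⟨φ, rfl⟩ : ∃ φ : (AdelicGroupData.gl (m + 1) K).automorphicQuotient → ℂ,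
      invQuot (AdelicGroupData.gl (m + 1) K) φ = Φ :=
    ⟨_, (AdelicGroupData.gl (m + 1) K).invQuot_descend Φ
      ((AdelicGroupData.gl (m + 1) K).leftInvariant_quotientSubgroup hcusp.1.leftInvariant hΦA)⟩
  obtain ⟨φ', rfl⟩ : ∃ φ' : (AdelicGroupData.gl m K).automorphicQuotient → ℂ,
      invQuot (AdelicGroupData.gl m K) φ' = Φ' :=
    ⟨_, (AdelicGroupData.gl m K).invQuot_descend Φ'
      ((AdelicGroupData.gl m K).leftInvariant_quotientSubgroup hcusp'.1.leftInvariant hΦ'A)⟩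
  -- (b) an automorphic measure on `X_m`
  obtain ⟨μ', hμ'⟩ := AdelicGroupData.exists_isAutomorphicMeasure_gl_holds m K
  -- (c)–(d) the global corner theorem in the Whittaker coefficients on a right half-plane
  obtain ⟨C, x₀, hC, h⟩ := jpssIntegral_star_add_half_eq hm μ' νA νK ν₀ ν₀' hcusp hcusp'
  -- (e) the entire function `J(s) = C⁻¹ I(s + 1/2; φ, φ̄')`
  have hφ'star : IsCuspFormGL m K (isCompact_glFiniteIntegralLevel_holds m K)
      (invQuot (AdelicGroupData.gl m K) (star φ')) := hcusp'.star
  have hd : Differentiable ℂ (jpssIntegral (Nat.lt_succ_self m) μ' φ (star φ')) :=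
    (differentiable_jpssIntegral_of_isCuspFormGL hm (Nat.lt_succ_self m) hcusp (φ' := star φ') hφ'star).1
  refine ⟨x₀, fun s => (C : ℂ)⁻¹ * jpssIntegral (Nat.lt_succ_self m) μ' φ (star φ') (s + 1 / 2), ?_,
    fun s hs => ?_⟩
  · exact (hd.comp (differentiable_id.add_const _)).const_mul _
  · beta_reduce
    rw [h s hs, ← mul_assoc, inv_mul_cancel₀ (Complex.ofReal_ne_zero.2 hC.ne'), one_mul]

end Summit.Langlands.Langlands.Theorems.GapEntireFactSucc

end
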